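import Summits.Ventures.LatticeQCDFlow.Exactness.ReversiblePositive
import Summits.Ventures.LatticeQCDFlow.Exactness.ReversibleLazyChain
import Summits.Ventures.LatticeQCDFlow.Exactness.ReversibleMixture
import HarnessLib

/-!
# Positive samplers are closed under mixtures and lazification; the HALF-LAZY version of ANY reversible exact sampler is positive

HONEST FRAMING: exact (Metropolis-corrected) sampling algorithms for lattice gauge theory;
figures of merit are autocorrelation/cost numbers at stated couplings and volumes; no
continuum-physics claim.  (SCALAR calibration rung S0-A: not a gauge result.)

Venture `LatticeQCDFlow` (cell pub-lqcd), topic `Exactness`; FANOUT row 2 (`s0-phi4`).  NEW WORK of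
the cell in the `RevOp` format, complementing `Exactness/ReversiblePositive.lean` ((pos):
`0 ≤ ∫ f (K f) w` on the class), `Exactness/ReversibleTwoStep.lean` (`K ∘ K` is always positive),
gen-18's `ReversibleLazyChain` (`K^{(p)} = (1 − p)K + p·1`, `τ^{(p)} + ½ = (τ + ½)/(1 − p)`) and
`ReversibleMixture` (`M = aK₁ + (1 − a)K₂`).  Nothing is cited as a fact.  Printed counterpart NAMED
ONLY: the standard "lazy chain" device of mixing-time theory (e.g. Levin–Peres–Wilmer, *Markov Chains
and Mixing Times*, §12.1: the lazy chain `(P + I)/2` has nonnegative spectrum); Rudolf–Ullrich 2013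
(lazy Metropolis, Novak–Rudolf 2014 survey §3).

## What is proved (namespace `RevOp`)

* **`lazy_pos_of_half_le`** — for EVERY reversible exact sampler `K` (no positivity) and every
  `p ∈ [½, 1]`, the lazy operator `L = (1 − p)K + p·1` is positive on the class:
  `∫ f (L f) w ≥ (2p − 1) ∫ f² w ≥ 0` — so every conclusion of `ReversiblePositive{,TauInt,Thinning}`
  holds for the half-lazy HMC / half-lazy window-Metropolis chain, whose `τ + ½` is exactly twice
  the original one (`ReversibleLazyChain.tauInt_lazy_eq`): laziness buys monotone, convex,
  nonnegative autocorrelations of every observable at a known price;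
* **`lazy_pos`** — if `K` is positive then so is `(1 − p)K + p·1` for every `p ∈ [0, 1]`;
* **`mix_pos`** — if `K₁`, `K₂` are positive then so is `aK₁ + (1 − a)K₂`, `a ∈ [0, 1]` (the flow +
  Gaussian-Metropolis hybrid of `Phi4FlowHMCHybrid`-type is positive when both components are);
* **`lazy_autocov_nonneg_antitone`** — the packaged consequence for the half-lazy chain of any
  reversible sampler: all its autocovariances are `≥ 0` and nonincreasing.

NOT CLAIMED: positivity of `(1 − p)K + p·1` for `p < ½` without positivity of `K` (false in general);
any number for any run.
-/

namespace Summit.Ventures.LatticeQCDFlow.Exactness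

open Real MeasureTheory Filter Finset
open Summit.Ventures.LatticeQCDFlow.Scoring

namespace RevOp

variable {X : Type*} [MeasurableSpace X] {μ : Measure X} {w : X → ℝ} {A : (X → ℝ) → Prop}
  {K K₁ K₂ L M : (X → ℝ) → (X → ℝ)} {p a : ℝ}

/-- **THE HALF-LAZY VERSION OF ANY REVERSIBLE EXACT SAMPLER IS POSITIVE**: for `½ ≤ p ≤ 1`,
`∫ f (L f) w ≥ (2p − 1) ∫ f² w ≥ 0`, `L = (1 − p)K + p·1` (since `∫ f (K f) w ≥ −∫ f² w`). -/
theorem lazy_pos_of_half_le (hw0 : ∀ x, 0 ≤ w x)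
    (hAi : ∀ ⦃f h : X → ℝ⦄, A f → A h → Integrable (fun x => f x * h x * w x) μ)
    (hAK : ∀ ⦃f : X → ℝ⦄, A f → A (K f))
    (hcontr : ∀ ⦃f : X → ℝ⦄, A f → ∫ x, K f x ^ 2 * w x ∂μ ≤ ∫ x, f x ^ 2 * w x ∂μ)
    (hL : ∀ f x, L f x = (1 - p) * K f x + p * f x) (hp : 1 / 2 ≤ p) (hp1 : p ≤ 1)
    {f : X → ℝ} (hf : A f) :
    (2 * p - 1) * ∫ x, f x ^ 2 * w x ∂μ ≤ ∫ x, f x * L f x * w x ∂μ ∧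
    0 ≤ ∫ x, f x * L f x * w x ∂μ := by
  have hP0 : 0 ≤ ∫ x, f x ^ 2 * w x ∂μ := integral_nonneg fun x => mul_nonneg (sq_nonneg _) (hw0 x)
  have hb := abs_autocov_le hw0 hAi hAK hcontr hf 1
  simp only [Function.iterate_one] at hb
  have hlow : -∫ x, f x ^ 2 * w x ∂μ ≤ ∫ x, f x * K f x * w x ∂μ := (abs_le.1 hb).1
  have e : ∫ x, f x * L f x * w x ∂μ
      = (1 - p) * (∫ x, f x * K f x * w x ∂μ) + p * ∫ x, f x ^ 2 * w x ∂μ := by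
    have e1 : ∀ x, f x * L f x * w x = (1 - p) * (f x * K f x * w x) + p * (f x ^ 2 * w x) := by
      intro x; rw [hL]; ring
    simp_rw [e1]
    rw [integral_add ((hAi hf (hAK hf)).const_mul _) ((integrable_sq_mul hAi hf).const_mul _),
      integral_const_mul, integral_const_mul]
  rw [e]
  constructor
  · nlinarith [mul_le_mul_of_nonneg_left hlow (sub_nonneg.2 hp1)]
  · nlinarith [mul_le_mul_of_nonneg_left hlow (sub_nonneg.2 hp1)]

/-- **Lazification preserves positivity**: `K` positive, `0 ≤ p ≤ 1` ⇒ `(1 − p)K + p·1` positive. -/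
theorem lazy_pos (hw0 : ∀ x, 0 ≤ w x)
    (hAi : ∀ ⦃f h : X → ℝ⦄, A f → A h → Integrable (fun x => f x * h x * w x) μ)
    (hAK : ∀ ⦃f : X → ℝ⦄, A f → A (K f))
    (hpos : ∀ ⦃f : X → ℝ⦄, A f → 0 ≤ ∫ x, f x * K f x * w x ∂μ)
    (hL : ∀ f x, L f x = (1 - p) * K f x + p * f x) (hp0 : 0 ≤ p) (hp1 : p ≤ 1)
    {f : X → ℝ} (hf : A f) : 0 ≤ ∫ x, f x * L f x * w x ∂μ := by
  have hP0 : 0 ≤ ∫ x, f x ^ 2 * w x ∂μ := integral_nonneg fun x => mul_nonneg (sq_nonneg _) (hw0 x)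
  have e1 : ∀ x, f x * L f x * w x = (1 - p) * (f x * K f x * w x) + p * (f x ^ 2 * w x) := by
    intro x; rw [hL]; ring
  simp_rw [e1]
  rw [integral_add ((hAi hf (hAK hf)).const_mul _) ((integrable_sq_mul hAi hf).const_mul _),
    integral_const_mul, integral_const_mul]
  exact add_nonneg (mul_nonneg (sub_nonneg.2 hp1) (hpos hf)) (mul_nonneg hp0 hP0)

/-- **Mixtures preserve positivity**: `K₁`, `K₂` positive, `0 ≤ a ≤ 1` ⇒ `aK₁ + (1 − a)K₂` positive. -/
theorem mix_pos (hAi : ∀ ⦃f h : X → ℝ⦄, A f → A h → Integrable (fun x => f x * h x * w x) μ)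
    (hAK₁ : ∀ ⦃f : X → ℝ⦄, A f → A (K₁ f)) (hAK₂ : ∀ ⦃f : X → ℝ⦄, A f → A (K₂ f))
    (hpos₁ : ∀ ⦃f : X → ℝ⦄, A f → 0 ≤ ∫ x, f x * K₁ f x * w x ∂μ)
    (hpos₂ : ∀ ⦃f : X → ℝ⦄, A f → 0 ≤ ∫ x, f x * K₂ f x * w x ∂μ)
    (hM : ∀ f x, M f x = a * K₁ f x + (1 - a) * K₂ f x) (ha0 : 0 ≤ a) (ha1 : a ≤ 1)
    {f : X → ℝ} (hf : A f) : 0 ≤ ∫ x, f x * M f x * w x ∂μ := by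
  have e1 : ∀ x, f x * M f x * w x = a * (f x * K₁ f x * w x) + (1 - a) * (f x * K₂ f x * w x) := by
    intro x; rw [hM]; ring
  simp_rw [e1]
  rw [integral_add ((hAi hf (hAK₁ hf)).const_mul _) ((hAi hf (hAK₂ hf)).const_mul _),
    integral_const_mul, integral_const_mul]
  exact add_nonneg (mul_nonneg ha0 (hpos₁ hf)) (mul_nonneg (sub_nonneg.2 ha1) (hpos₂ hf))

/-- **THE HALF-LAZY CHAIN OF ANY REVERSIBLE SAMPLER DECORRELATES MONOTONICALLY**: `½ ≤ p ≤ 1`,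
`L = (1 − p)K + p·1`; for every `u ∈ A` and every lag, `0 ≤ ∫ u (L^{k+1} u) w ≤ ∫ u (Lᵏ u) w`. -/
theorem lazy_autocov_nonneg_antitone (hw0 : ∀ x, 0 ≤ w x)
    (hAi : ∀ ⦃f h : X → ℝ⦄, A f → A h → Integrable (fun x => f x * h x * w x) μ)
    (hAc : ∀ ⦃f h : X → ℝ⦄ (c : ℝ), A f → A h → A (fun x => f x + c * h x))
    (hAK : ∀ ⦃f : X → ℝ⦄, A f → A (K f))
    (hlin : ∀ ⦃f h : X → ℝ⦄ (c : ℝ), A f → A h →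
      ∀ x, K (fun s => f s + c * h s) x = K f x + c * K h x)
    (hsymm : ∀ ⦃f h : X → ℝ⦄, A f → A h →
      ∫ x, K f x * h x * w x ∂μ = ∫ x, f x * K h x * w x ∂μ)
    (hcontr : ∀ ⦃f : X → ℝ⦄, A f → ∫ x, K f x ^ 2 * w x ∂μ ≤ ∫ x, f x ^ 2 * w x ∂μ)
    (hL : ∀ f x, L f x = (1 - p) * K f x + p * f x) (hp : 1 / 2 ≤ p) (hp1 : p ≤ 1)
    {u : X → ℝ} (hu : A u) (k : ℕ) :
    0 ≤ ∫ x, u x * (L^[k + 1] u) x * w x ∂μ ∧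
    ∫ x, u x * (L^[k + 1] u) x * w x ∂μ ≤ ∫ x, u x * (L^[k] u) x * w x ∂μ := by
  have hp0 : 0 ≤ p := le_trans (by norm_num) hp
  have hLK : ∀ ⦃f : X → ℝ⦄, A f → A (L f) := fun f hf => lazy_mem hAc hAK hL hf
  have hLlin : ∀ ⦃f h : X → ℝ⦄ (c : ℝ), A f → A h →
      ∀ x, L (fun s => f s + c * h s) x = L f x + c * L h x :=
    fun f h c hf hh x => lazy_add_mul hlin hL c hf hh x
  have hLsymm : ∀ ⦃f h : X → ℝ⦄, A f → A h →
      ∫ x, L f x * h x * w x ∂μ = ∫ x, f x * L h x * w x ∂μ :=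
    fun f h hf hh => lazy_symm hAi hAK hsymm hL hf hh
  have hLcontr : ∀ ⦃f : X → ℝ⦄, A f → ∫ x, L f x ^ 2 * w x ∂μ ≤ ∫ x, f x ^ 2 * w x ∂μ :=
    fun f hf => lazy_contr hw0 hAi hAc hAK hcontr hL hp0 hp1 hf
  have hLpos : ∀ ⦃f : X → ℝ⦄, A f → 0 ≤ ∫ x, f x * L f x * w x ∂μ :=
    fun f hf => (lazy_pos_of_half_le hw0 hAi hAK hcontr hL hp hp1 hf).2
  exact ⟨autocov_nonneg_of_pos hw0 hLK hLsymm hLpos hu (k + 1),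
    autocov_succ_le_of_pos hw0 hAi hAc hLK hLlin hLsymm hLcontr hLpos hu k⟩

end RevOp

end Summit.Ventures.LatticeQCDFlow.Exactness
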